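import Mathlib
import Summits.QuantumAdvantage.QuantumAdvantage.Theorems.WhiteBoxWalkWbwVerifiableLineNoSpeedupCycleSurgeryAdversaryDefs
import Summits.QuantumAdvantage.QuantumAdvantage.Theorems.WhiteBoxWalkWbwVerifiableLineNoSpeedupCycleSurgeryPartner
import Summits.QuantumAdvantage.QuantumAdvantage.Theorems.WhiteBoxWalkWbwVerifiableLineNoSpeedupCycleSurgeryGoodSet

/-!
# Crux `WhiteBoxWalk.WbwVerifiableLineNoSpeedup` (stmt-QuantumAdvantage-2239), line
`cycle-surgery-adversary` — registered stub `stub_degrees` (lead prover)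

The min-degree bound of the cycle-surgery relation on both sides, `dstar = hid · 2^m / 8 ≤ leftDeg`
on `famX` and `≤ rightDeg` on `famY`, plus nonemptiness of both sides, from the three counting
statements (partner family membership `stub_partnerFamily`, the parity count `stub_goodSetCard`, and
nonemptiness `stub_familyNonempty`, the last taken as a hypothesis): the map
`(k, v) ↦ S * swap(x_k, v)` / `(k, q) ↦ S * swap(x_k, x_q)` injects the good parameters of the `hid`
cuts into the partners (`card_partners_ge`); the odd side is transported by `IsSurgery.symm`.
Sorry-free. -/

noncomputable section

set_option linter.dupNamespace false

namespace Summit.QuantumAdvantage.QuantumAdvantage.Theorems.WbwVerifiableLineNoSpeedup.CycleSurgery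

open Literature.Computability.Cryptography Literature.Computability.QuantumComplexity

/-! ## §6 The min-degree bound (lead prover; registered stub `stub_degrees`, composed here) -/

section Degrees

variable {m T : ℕ}

/-- Two equal transpositions `swap(a₁, w₁) = swap(a₂, w₂)` with `a₁, a₂` on the line and `w₁` off it
have `a₁ = a₂` and `w₁ = w₂`. -/
theorem swap_eq_swap_offLine {S : Equiv.Perm (Fin (2 ^ m))} {k₁ k₂ : ℕ} (hk₁ : k₁ ≤ T) (hk₂ : k₂ ≤ T)
    {w₁ w₂ : Fin (2 ^ m)} (hw₁ : ∀ i : ℕ, i ≤ T → w₁ ≠ pt S i)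
    (h : Equiv.swap (pt S k₁) w₁ = Equiv.swap (pt S k₂) w₂) : pt S k₁ = pt S k₂ ∧ w₁ = w₂ := by
  have h1 : Equiv.swap (pt S k₂) w₂ (pt S k₁) = w₁ := by rw [← h, Equiv.swap_apply_left]
  by_cases hk : pt S k₁ = pt S k₂
  · refine ⟨hk, ?_⟩
    rw [hk, Equiv.swap_apply_left] at h1
    exact h1.symm
  · exfalso
    by_cases hkw : pt S k₁ = w₂
    · rw [hkw, Equiv.swap_apply_right] at h1
      exact hw₁ k₂ hk₂ h1.symm
    · rw [Equiv.swap_apply_of_ne_of_ne hk hkw] at h1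
      exact hw₁ k₁ hk₁ h1.symm

/-- **Counting the partners of one family member.** Given the partner-family and good-set stubs, a family
member `S` (with `4 ≤ m`, `1 ≤ T`, `T + 1 ≤ 2^(m-1)`) has at least `hid · 2^(m-3)` surgeries `S'` with
`IsSurgery m T S S'` and sink parity `b`: the map `(k, v) ↦ S * swap(x_k, v)` (merge vertices) /
`(k, q) ↦ S * swap(x_k, x_q)` (far-split positions) is injective on the good parameters of the `hid` cuts
`pre ≤ k < T`. -/
theorem card_partners_ge (hP : type_of% stub_partnerFamily) (hG : type_of% stub_goodSetCard)
    {S : Equiv.Perm (Fin (2 ^ m))} (b : Bool) (hm : 4 ≤ m) (hT : 1 ≤ T) (hTm : T + 1 ≤ 2 ^ (m - 1))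
    (hS : InFamily m T S) (P : Finset (Equiv.Perm (Fin (2 ^ m))))
    (hPmem : ∀ S' : Equiv.Perm (Fin (2 ^ m)), IsSurgery m T S S' → sinkOdd m T S' = b → S' ∈ P) :
    hid m T * 2 ^ (m - 3) ≤ P.card := by
  classical
  have hinjS := hS.2.1
  have hL : T < srcPeriod S := lt_srcPeriod_of_injective hinjS
  have hph : pre m T + hid m T = T := pre_add_hid m T
  -- the parameter set and the partner map
  set E : Finset (Σ _ : ℕ, Fin (2 ^ m) ⊕ ℕ) :=
    (Finset.Ico (pre m T) T).sigma fun k => (mergeGood m T S k b).disjSum (splitGood m T S k b) with hE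
  let w : Fin (2 ^ m) ⊕ ℕ → Fin (2 ^ m) := fun s => Sum.elim id (pt S) s
  let Φ : (Σ _ : ℕ, Fin (2 ^ m) ⊕ ℕ) → Equiv.Perm (Fin (2 ^ m)) := fun e =>
    S * Equiv.swap (pt S e.1) (w e.2)
  -- size of the parameter set
  have hcardE : hid m T * 2 ^ (m - 3) ≤ E.card := by
    rw [hE, Finset.card_sigma]
    calc hid m T * 2 ^ (m - 3) = ∑ _k ∈ Finset.Ico (pre m T) T, 2 ^ (m - 3) := by
          rw [Finset.sum_const, Nat.card_Ico, smul_eq_mul]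
          congr 1
          omega
      _ ≤ ∑ k ∈ Finset.Ico (pre m T) T, ((mergeGood m T S k b).disjSum (splitGood m T S k b)).card :=
          Finset.sum_le_sum fun k hk => by
            rw [Finset.card_disjSum]
            exact hG m T S k b hm hT hTm hS (Finset.mem_Ico.1 hk).1 (Finset.mem_Ico.1 hk).2
  -- unpacking a parameter: the cut, the vertex (off the line), family membership and the sink
  have hparam : ∀ e ∈ E, pre m T ≤ e.1 ∧ e.1 < T ∧ (∀ i : ℕ, i ≤ T → w e.2 ≠ pt S i) ∧
      InFamily m T (Φ e) ∧ sinkOdd m T (Φ e) = b ∧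
        (∀ v, e.2 = Sum.inl v → OffCycle S v) ∧ (∀ q, e.2 = Sum.inr q → q < srcPeriod S) := by
    rintro ⟨k, s⟩ he
    rw [hE, Finset.mem_sigma, Finset.mem_Ico] at he
    obtain ⟨⟨hk, hkT⟩, hs⟩ := he
    obtain ⟨hmerge, hsplit⟩ := hP m T S k hS hk hkT
    rcases s with v | q
    · rw [Finset.inl_mem_disjSum, mem_mergeGood] at hs
      obtain ⟨hv, hpar⟩ := hs
      obtain ⟨hfam, hsink⟩ := hmerge v hv
      refine ⟨hk, hkT, fun i _ => (hv i).symm, hfam, ?_, fun v' hv' => ?_, fun q hq => ?_⟩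
      · change decide ((pt (S * Equiv.swap (pt S k) v) T).val % 2 = 1) = b
        rw [hsink]
        exact hpar
      · cases hv'; exact hv
      · cases hq
    · rw [Finset.inr_mem_disjSum, mem_splitGood] at hs
      obtain ⟨hq, hqL, hpar⟩ := hs
      obtain ⟨hfam, hsink⟩ := hsplit q hq hqL
      refine ⟨hk, hkT, fun i hi => ?_, hfam, ?_, fun v' hv' => ?_, fun q' hq' => ?_⟩
      · change pt S q ≠ pt S i
        exact pt_ne_pt_of_lt_of_lt (by omega) (by omega)
      · change decide ((pt (S * Equiv.swap (pt S k) (pt S q)) T).val % 2 = 1) = b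
        rw [hsink]
        exact hpar
      · cases hv'
      · cases hq'; omega
  -- `Φ` maps the parameters to partners
  have hmaps : Set.MapsTo Φ E P := by
    intro e he
    obtain ⟨hk, hkT, hw, hfam, hsink, -, -⟩ := hparam e he
    exact hPmem _ ⟨hS, hfam, e.1, hk, hkT, w e.2, hw, rfl⟩ hsink
  -- `Φ` is injective on the parameters
  have hinj : Set.InjOn Φ E := by
    intro e₁ he₁ e₂ he₂ heq
    obtain ⟨-, hk₁, hw₁, -, -, hl₁, hr₁⟩ := hparam e₁ he₁
    obtain ⟨-, hk₂, -, -, -, hl₂, hr₂⟩ := hparam e₂ he₂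
    have hsw : Equiv.swap (pt S e₁.1) (w e₁.2) = Equiv.swap (pt S e₂.1) (w e₂.2) :=
      mul_left_cancel heq
    obtain ⟨hkk, hww⟩ := swap_eq_swap_offLine hk₁.le hk₂.le hw₁ hsw
    have hk12 : e₁.1 = e₂.1 := pt_injOn_of_injective hinjS hk₁.le hk₂.le hkk
    obtain ⟨k₁, s₁⟩ := e₁
    obtain ⟨k₂, s₂⟩ := e₂
    simp only at hk12 hww hl₁ hr₁ hl₂ hr₂
    subst hk12
    rcases s₁ with v₁ | q₁ <;> rcases s₂ with v₂ | q₂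
    · simp only [w, Sum.elim_inl, id] at hww
      rw [hww]
    · exfalso
      simp only [w, Sum.elim_inl, Sum.elim_inr, id] at hww
      exact hl₁ v₁ rfl q₂ hww.symm
    · exfalso
      simp only [w, Sum.elim_inl, Sum.elim_inr, id] at hww
      exact hl₂ v₂ rfl q₁ hww
    · simp only [w, Sum.elim_inr] at hww
      have := pt_injOn_lt_srcPeriod S (hr₁ q₁ rfl) (hr₂ q₂ rfl) hww
      rw [this]
  exact hcardE.trans (Finset.card_le_card_of_injOn Φ hmaps hinj)

/-- `dstar = hid · 2^(m-3)` for `m ≥ 3`. -/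
theorem dstar_eq {m T : ℕ} (hm : 3 ≤ m) : dstar m T = ((hid m T * 2 ^ (m - 3) : ℕ) : ℝ) := by
  unfold dstar
  obtain ⟨m', rfl⟩ : ∃ m', m = m' + 3 := ⟨m - 3, by omega⟩
  simp only [Nat.add_sub_cancel, Nat.cast_mul, Nat.cast_pow, Nat.cast_ofNat, pow_add]
  ring

/-- **Registered stub `stub_degrees`, PROVED from its three counting hypotheses**: nonemptiness of both
sides and the min-degree bound `dstar ≤ leftDeg`, `dstar ≤ rightDeg` (odd side via `IsSurgery.symm`). -/
theorem stub_degrees :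
    (∀ (m T : ℕ) (S : Equiv.Perm (Fin (2 ^ m))) (k : ℕ), InFamily m T S → pre m T ≤ k → k < T →
      (∀ v : Fin (2 ^ m), OffCycle S v →
          InFamily m T (S * Equiv.swap (pt S k) v) ∧
            pt (S * Equiv.swap (pt S k) v) T = (S ^ (T - k)) v) ∧
      ∀ q : ℕ, k + hid m T < q → q + (T - k) < srcPeriod S →
          InFamily m T (S * Equiv.swap (pt S k) (pt S q)) ∧
            pt (S * Equiv.swap (pt S k) (pt S q)) T = pt S (q + (T - k))) →
    (∀ (m T : ℕ) (S : Equiv.Perm (Fin (2 ^ m))) (k : ℕ) (b : Bool), 4 ≤ m → 1 ≤ T →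
      T + 1 ≤ 2 ^ (m - 1) → InFamily m T S → pre m T ≤ k → k < T →
        2 ^ (m - 3) ≤ (mergeGood m T S k b).card + (splitGood m T S k b).card) →
    (∀ m T : ℕ, 4 ≤ m → 1 ≤ T → T + 1 ≤ 2 ^ (m - 1) →
      (∃ S : Equiv.Perm (Fin (2 ^ m)), InFamily m T S ∧ sinkOdd m T S = false) ∧
        ∃ S : Equiv.Perm (Fin (2 ^ m)), InFamily m T S ∧ sinkOdd m T S = true) →
    ∀ m T : ℕ, 4 ≤ m → 1 ≤ T → T + 1 ≤ 2 ^ (m - 1) →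
      (famX m T).Nonempty ∧ (famY m T).Nonempty ∧
        (∀ t ∈ famX m T, dstar m T ≤ (leftDeg (rel m T) t : ℝ)) ∧
          ∀ t ∈ famY m T, dstar m T ≤ (rightDeg (rel m T) t : ℝ) := by
  intro hP hG hN m T hm hT hTm
  classical
  obtain ⟨⟨S₀, hS₀, h0⟩, ⟨S₁, hS₁, h1⟩⟩ := hN m T hm hT hTm
  refine ⟨⟨permInstance m T S₀, mem_famX.2 ⟨S₀, ⟨hS₀, h0⟩, rfl⟩⟩,
    ⟨permInstance m T S₁, mem_famY.2 ⟨S₁, ⟨hS₁, h1⟩, rfl⟩⟩, ?_, ?_⟩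
  · -- even side: partners `S'` of `S`, embedded as `(t, permInstance S')`
    intro t ht
    obtain ⟨S, ⟨hS, hSev⟩, rfl⟩ := mem_famX.1 ht
    rw [dstar_eq (by omega)]
    have key := card_partners_ge hP hG true hm hT hTm hS
      ((Finset.univ.filter fun S' : Equiv.Perm (Fin (2 ^ m)) =>
        IsSurgery m T S S' ∧ sinkOdd m T S' = true))
      (fun S' h1 h2 => Finset.mem_filter.2 ⟨Finset.mem_univ _, h1, h2⟩)
    refine Nat.cast_le.2 (key.trans ?_)
    unfold leftDeg
    refine Finset.card_le_card_of_injOn (fun S' => (permInstance m T S, permInstance m T S'))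
      (fun S' hS' => ?_) (fun S₁' _ S₂' _ h => permInstance_injective (Prod.mk.inj h).2)
    rw [Finset.coe_filter, Set.mem_setOf_eq] at hS'
    rw [Finset.coe_filter, Set.mem_setOf_eq]
    exact ⟨mk_mem_rel_iff.2 ⟨hS'.2.1, hSev, hS'.2.2⟩, rfl⟩
  · -- odd side: partners `S''` of `S'` with even sink, as `(permInstance S'', t')`, by symmetry
    intro t ht
    obtain ⟨S', ⟨hS', hSodd⟩, rfl⟩ := mem_famY.1 ht
    rw [dstar_eq (by omega)]
    have key := card_partners_ge hP hG false hm hT hTm hS'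
      ((Finset.univ.filter fun S'' : Equiv.Perm (Fin (2 ^ m)) =>
        IsSurgery m T S' S'' ∧ sinkOdd m T S'' = false))
      (fun S'' h1 h2 => Finset.mem_filter.2 ⟨Finset.mem_univ _, h1, h2⟩)
    refine Nat.cast_le.2 (key.trans ?_)
    unfold rightDeg
    refine Finset.card_le_card_of_injOn (fun S'' => (permInstance m T S'', permInstance m T S'))
      (fun S'' hS'' => ?_) (fun S₁ _ S₂ _ h => permInstance_injective (Prod.mk.inj h).1)
    rw [Finset.coe_filter, Set.mem_setOf_eq] at hS''
    rw [Finset.coe_filter, Set.mem_setOf_eq]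
    exact ⟨mk_mem_rel_iff.2 ⟨hS''.2.1.symm, hS''.2.2, hSodd⟩, rfl⟩

end Degrees

end Summit.QuantumAdvantage.QuantumAdvantage.Theorems.WbwVerifiableLineNoSpeedup.CycleSurgery

end
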